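import Summits.QuantumAdvantage.QuantumAdvantage.Theorems.AnchorDialChainF

/-!
# AnchorDial — part 23 «OrbitInv» (cell decomp-qadv, seat lens-2, generation 15; supports item 26531 `ExactnessDial.PolyLossOddU3`)

§F of the g15 node «GaugeDial»: orbit involution and commutation (`fz_fz`, `fz_comm`, `orbL_fz`, `orbL_invol`),
counting under the orbit map (`card_filter_orbL`, `card_filter_orbF`, `orbF_false`), composition with low degree
(`comp_orbL_mem`, `comp_orbF_mem`), the pair-flip instability predicate `UBP A a y` and the instability cover along the
orbit `card_anc_change_le : #{odd, anchor set not constant on the orbit} ≤ 2^F · Σ_i #{odd, unstable at b_i}`.  Namespace `…Theorems.AnchorDial`; imports part 22.  Verbatim from the node file; no `sorry`, no `native_decide`, no instances/notation; lint-clean without the unusedVariables switch.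
-/

set_option linter.dupNamespace false

/-! ## §F  Orbit involution, counting under the orbit map, and the instability cover along the orbit -/

noncomputable section

open scoped Classical

namespace Summit.QuantumAdvantage.QuantumAdvantage.Theorems.AnchorDial

open Finset
open Literature.Computability.QuantumComplexity Literature.Computability.QuantumComplexity.RingHLF
open Literature.Computability.MetaComplexity Literature.Computability.MetaComplexity.Smolensky
open Summit.QuantumAdvantage.AdviceFreeQNC0
open Summit.QuantumAdvantage.QuantumAdvantage.Theorems.HolonomyDial (gCond selP selP_mem selP_apply indP indP_mem indP_apply)

variable {N : ℕ}

section OrbitInv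

variable {F : ℕ}

/-- AnchorDialOrbitInv helper `fz_fz` (decomp-qadv land package; see the module docstring). -/
theorem fz_fz (e : Bool) (a : ℕ) (x : Fin N → Bool) : fz e a (fz e a x) = x := by
  cases e
  · rfl
  · funext j
    show flip2 a (a + 1) (flip2 a (a + 1) x) j = x j
    by_cases h : j.val = a ∨ j.val = a + 1 <;> simp [flip2, h]

/-- AnchorDialOrbitInv helper `fz_comm` (decomp-qadv land package; see the module docstring). -/
theorem fz_comm (e e' : Bool) (a a' : ℕ) (x : Fin N → Bool) : fz e a (fz e' a' x) = fz e' a' (fz e a x) := by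
  cases e <;> cases e' <;> try rfl
  funext j
  show flip2 a (a + 1) (flip2 a' (a' + 1) x) j = flip2 a' (a' + 1) (flip2 a (a + 1) x) j
  by_cases h : j.val = a ∨ j.val = a + 1 <;> by_cases h' : j.val = a' ∨ j.val = a' + 1 <;> simp [flip2, h, h']

/-- AnchorDialOrbitInv helper `orbL_fz` (decomp-qadv land package; see the module docstring). -/
theorem orbL_fz (l : List (Bool × ℕ)) (e : Bool) (a : ℕ) (x : Fin N → Bool) :
    orbL l (fz e a x) = fz e a (orbL l x) := by
  induction l with
  | nil => rfl
  | cons p l ih => rw [orbL_cons, orbL_cons, ih, fz_comm]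

/-- AnchorDialOrbitInv helper `orbL_invol` (decomp-qadv land package; see the module docstring). -/
theorem orbL_invol (l : List (Bool × ℕ)) (x : Fin N → Bool) : orbL l (orbL l x) = x := by
  induction l with
  | nil => rfl
  | cons p l ih => rw [orbL_cons, orbL_cons, orbL_fz, fz_fz, ih]

/-- the orbit map is a bijection of the cube: counting is invariant. -/
theorem card_filter_orbL (Q : (Fin N → Bool) → Prop) [DecidablePred Q] (l : List (Bool × ℕ)) :
    (univ.filter fun x => Q (orbL l x)).card = (univ.filter fun x => Q x).card := by
  refine Finset.card_bij' (fun x _ => orbL l x) (fun y _ => orbL l y) ?_ ?_ ?_ ?_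
  · intro x hx
    rw [mem_filter] at hx ⊢
    exact ⟨mem_univ _, hx.2⟩
  · intro y hy
    rw [mem_filter] at hy ⊢
    refine ⟨mem_univ _, ?_⟩
    rw [orbL_invol]; exact hy.2
  · intro x hx; exact orbL_invol l x
  · intro y hy; exact orbL_invol l y

/-- AnchorDialOrbitInv helper `card_filter_orbF` (decomp-qadv land package; see the module docstring). -/
theorem card_filter_orbF (Q : (Fin N → Bool) → Prop) [DecidablePred Q] (b : Fin F → ℕ) (ε : Fin F → Bool) :
    (univ.filter fun x => Q (orbF b ε x)).card = (univ.filter fun x => Q x).card :=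
  card_filter_orbL Q _

/-- AnchorDialOrbitInv helper `orbF_false` (decomp-qadv land package; see the module docstring). -/
theorem orbF_false (b : Fin F → ℕ) (x : Fin N → Bool) : orbF b (fun _ => false) x = x := by
  unfold orbF
  suffices h : ∀ l : List (Bool × ℕ), (∀ p ∈ l, p.1 = false) → orbL l x = x from
    h _ (List.forall_mem_ofFn_iff.2 fun i => rfl)
  intro l hl
  induction l with
  | nil => rfl
  | cons p l ih =>
    rw [orbL_cons, ih (fun q hq => hl q (List.mem_cons_of_mem _ hq)), hl p (by simp)]
    rfl

/-- where along a chain of optional flips a quantity changes. -/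
theorem orbL_change {α : Type*} (Q : (Fin N → Bool) → α) (x : Fin N → Bool) :
    ∀ l : List (Bool × ℕ), Q (orbL l x) ≠ Q x →
      ∃ n, n < l.length ∧ Q (orbL (l.drop n) x) ≠ Q (orbL (l.drop (n + 1)) x)
  | [] => by intro h; exact absurd rfl h
  | p :: l => by
      intro h
      by_cases h0 : Q (orbL (p :: l) x) = Q (orbL l x)
      · have h' : Q (orbL l x) ≠ Q x := by rwa [h0] at h
        obtain ⟨n, hn, hne⟩ := orbL_change Q x l h'
        exact ⟨n + 1, by simp only [List.length_cons]; omega, by simpa only [List.drop_succ_cons] using hne⟩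
      · exact ⟨0, by simp, by simpa only [List.drop_zero, List.drop_succ_cons] using h0⟩

/-- low degree is preserved by the orbit substitution. -/
theorem comp_orbL_mem {D : ℕ} : ∀ (l : List (Bool × ℕ)) {P : CubeFn (ZMod 3) N}, P ∈ lowDeg (ZMod 3) N D →
    (fun x => P (orbL l x)) ∈ lowDeg (ZMod 3) N D
  | [], P, hP => hP
  | p :: l, P, hP => by
      have h := comp_orbL_mem l (comp_fz_mem hP p.1 p.2)
      exact h

/-- AnchorDialOrbitInv helper `comp_orbF_mem` (decomp-qadv land package; see the module docstring). -/
theorem comp_orbF_mem {D : ℕ} {P : CubeFn (ZMod 3) N} (hP : P ∈ lowDeg (ZMod 3) N D) (b : Fin F → ℕ)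
    (ε : Fin F → Bool) : (fun x => P (orbF b ε x)) ∈ lowDeg (ZMod 3) N D :=
  comp_orbL_mem _ hP

/-- adjacent pair-flip instability of an anchor family at site `a` (the STAB predicate of `MAnchorable`). -/
def UBP (A : Fin N → CubeFn (ZMod 3) N) (a : ℕ) (y : Fin N → Bool) : Prop :=
  ∃ k : Fin N, ¬ ((A k (flip2 a (a + 1) y) = 1) ↔ (A k y = 1))

/-- AnchorDialOrbitInv helper `ubp_of_anc_ne` (decomp-qadv land package; see the module docstring). -/
theorem ubp_of_anc_ne (A : Fin N → CubeFn (ZMod 3) N) (a : ℕ) (y : Fin N → Bool)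
    (h : anc A (flip2 a (a + 1) y) ≠ anc A y) : UBP A a y := by
  by_contra hc
  unfold UBP at hc
  push Not at hc
  exact h (Finset.ext fun k => by simp only [anc, mem_filter, mem_univ, true_and]; exact hc k)

/-- **instability cover along the orbit**: if a family's anchor set changes somewhere on the `2^F`-orbit of an odd
input, some single flip at some partial orbit point destabilises it; counting through the bijective partial orbit maps,
`#{odd, anchor set not constant on the orbit} ≤ 2^F · Σ_i #{odd, unstable at b_i}`. -/
theorem card_anc_change_le (A : Fin N → CubeFn (ZMod 3) N) (b : Fin F → ℕ) (hbN : ∀ i, b i + 3 ≤ N) :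
    (univ.filter fun x : Fin N → Bool => OddZeros x ∧ ∃ ε, anc A (orbF b ε x) ≠ anc A x).card ≤
      2 ^ F * ∑ i : Fin F, (univ.filter fun y : Fin N → Bool => OddZeros y ∧ UBP A (b i) y).card := by
  set l : (Fin F → Bool) → List (Bool × ℕ) := fun ε => List.ofFn fun i => (ε i, b i) with hl
  have hlen : ∀ ε, (l ε).length = F := fun ε => by simp [hl]
  have hsub : (univ.filter fun x : Fin N → Bool => OddZeros x ∧ ∃ ε, anc A (orbF b ε x) ≠ anc A x) ⊆
      univ.biUnion fun ε : Fin F → Bool => univ.biUnion fun i : Fin F =>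
        univ.filter fun x : Fin N → Bool =>
          OddZeros (orbL ((l ε).drop (i.val + 1)) x) ∧ UBP A (b i) (orbL ((l ε).drop (i.val + 1)) x) := by
    intro x hx
    rw [mem_filter] at hx
    obtain ⟨_, hodd, ε, hne⟩ := hx
    have hne' : anc A (orbL (l ε) x) ≠ anc A x := hne
    obtain ⟨n, hn, hch⟩ := orbL_change (anc A) x (l ε) hne'
    rw [hlen] at hn
    rw [mem_biUnion]
    refine ⟨ε, mem_univ _, ?_⟩
    rw [mem_biUnion]
    refine ⟨⟨n, hn⟩, mem_univ _, ?_⟩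
    rw [mem_filter]
    have hget : (l ε).drop n = (ε ⟨n, hn⟩, b ⟨n, hn⟩) :: (l ε).drop (n + 1) := by
      rw [List.drop_eq_getElem_cons (by rw [hlen]; exact hn)]
      congr 1
      simp [hl, List.getElem_ofFn]
    rw [hget, orbL_cons] at hch
    have hsubl : ∀ p ∈ (l ε).drop (n + 1), p.2 + 2 ≤ N := fun p hp => by
      have hp' := List.mem_of_mem_drop hp
      simp only [hl, List.mem_ofFn] at hp'
      obtain ⟨i, rfl⟩ := hp'
      have := hbN i; simp only; omega
    refine ⟨mem_univ _, (oddZeros_orbL _ hsubl x).2 hodd, ?_⟩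
    set y := orbL ((l ε).drop (n + 1)) x
    have htrue : ε ⟨n, hn⟩ = true := by
      by_contra hf
      rw [Bool.not_eq_true] at hf
      simp only [hf] at hch
      exact hch rfl
    simp only [htrue] at hch
    exact ubp_of_anc_ne A (b ⟨n, hn⟩) y hch
  refine (card_le_card hsub).trans ?_
  refine card_biUnion_le.trans ?_
  have h2 : ∀ ε : Fin F → Bool, (univ.biUnion fun i : Fin F => univ.filter fun x : Fin N → Bool =>
      OddZeros (orbL ((l ε).drop (i.val + 1)) x) ∧ UBP A (b i) (orbL ((l ε).drop (i.val + 1)) x)).card ≤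
      ∑ i : Fin F, (univ.filter fun y : Fin N → Bool => OddZeros y ∧ UBP A (b i) y).card := by
    intro ε
    refine card_biUnion_le.trans (sum_le_sum fun i _ => ?_)
    rw [card_filter_orbL (fun y => OddZeros y ∧ UBP A (b i) y)]
  refine (sum_le_sum fun ε _ => h2 ε).trans ?_
  rw [sum_const, smul_eq_mul, card_univ, Fintype.card_fun, Fintype.card_bool, Fintype.card_fin]

end OrbitInv

end Summit.QuantumAdvantage.QuantumAdvantage.Theorems.AnchorDial

end
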